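import Summits.QuantumFields.YangMills.Theorems.UnitScaleTiltProp7TJRowOfEntry157
import Summits.QuantumFields.YangMills.Theorems.UnitScaleTiltProp7TJRowOfColumnsLift
import HarnessLib

/-!
# LIFT-THREAD 2 (★★OWNER RULING №30; namer ★w2-19200 g9 PEN ASSIGNMENT v1 17:22:48Z «px12 g11: T1»; token convention (α)(β)(γ) 17:25:31Z) — T1 door twin of
# ✓`UnitScaleTiltProp7TJRowOfEntry157`: the theorems `hTJ_of_hHcol_h157` VERBATIM with the OPAQUE predicate binder
# `(Lift : ∀ (L : ℕ) (i : Idx L), GaugeField (i.1.1.P i.1.2.2) 0 (Matrix.specialUnitaryGroup (Fin 2) ℂ) → Prop)` (first explicit binder) and the antecedent `Lift L i U₀ →` inserted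
# immediately after the last regularity guard (`RegPr … (α L) U₀ →` ∕ `ρ ≤ α L →`) in the N06-derived rows `hHcol` AND in the op-shaped conclusion; proofs = v1's with
# `hLift` introduced and passed through.  Letters of the v1 file are used BY NAME (imported, not restated).

Cell `ym3-torus`, width seat `ym3-torus-px12` (gen 11).  THEOREMS ONLY (0 `def`, 0 `sorry`); `--supports stmt-QuantumFields-19200 --as helper`, count-neutral.  WHY: px12 g11 LOCATE
«STRATUM (c) AND THE 13 N06 ROWS» (19200 evidence n = 49) + ✓p734809 `Prop7PcolImpliesNSPoincare`: the intrinsic `R_S`-rows of the EX display are inhabitable only on the lift locus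
(`U₀` whose top-level parallel sections lift), so the display S43ᴸT2 carries `Lift L i U₀ →` on the 13 print rows and every door between the display and the junction threads it.
HONEST SCOPE: bookkeeping twin; nothing of print asserted beyond the v1 file; no row, stub or crux is proved; YM₃ on T³ = rung R3 — NOT d = 4, NOT infinite volume, NOT a mass gap, NOT Clay.
References: as in ✓`UnitScaleTiltProp7TJRowOfEntry157` (T. Bałaban, CMP 99 (1985) 389–434 [Balaban1985BackgroundPropagators]; CMP 102 (1985) 277–309 [Balaban1985Variational]).
-/

set_option autoImplicit false

noncomputable section

open scoped InnerProductSpace ComplexConjugate Matrix.Norms.L2Operator BigOperators Matrix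


open Literature.MathematicalPhysics.QuantumFieldTheory.Balaban1983to89
open Literature.MathematicalPhysics.QuantumFieldTheory.Balaban1983to89.T3ContinuumYM3Torus
open Literature.MathematicalPhysics.QuantumFieldTheory.Balaban1983to89.T3Thm1Carrier (Idx)
open T3SectALandauChart (eta eta_pos)
open T3PrintedRegularMinimiser (RegPr)
open B9SectCLatticeCarrier (Bond)
open B11Eq90V0primeCurrent (flat115)
open Summit.QuantumFields.YangMills.Theorems.Prop7SectET3Transport (periodsT3)
open Summit.QuantumFields.YangMills.Theorems.Prop7SectET3HilbertLetters (toL2)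
open Summit.QuantumFields.YangMills.Theorems.Prop7SectET3CurvedPropagators (H1f)
open Summit.QuantumFields.YangMills.Theorems.Prop7SectET3DeltaPiPInv (DeltaPiSlotP)
open Summit.QuantumFields.YangMills.Theorems.Prop7SectET3DeltaOne (avgHess avgHess_def)
open Summit.QuantumFields.YangMills.Theorems.Prop7SectET3DeltaOnePInv (TJSlotP)
open Summit.QuantumFields.YangMills.Theorems.Prop7SymAvgTwSym (logChartTwS QTwS CmapTwS QTwS_def CmapTwS_apply)
open Summit.QuantumFields.YangMills.Theorems.Prop7CmapTwSymInputs (analyticOnNhd_logChartTwS)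
open Summit.QuantumFields.YangMills.Theorems.Prop7CmapTwSCoarseColumn (sum_norm_fderiv_CmapTwS_apply_le_of_entry_row)

open Filter Topology Metric Set

variable {F : T3Family} {n K : ℕ} {h : n ≤ K}

namespace Summit.QuantumFields.YangMills.Theorems.Prop7TJRowOfEntry157Lift

open Summit.QuantumFields.YangMills.Theorems.Prop7TJRowOfEntry157

/-- ★★★ **THE FAMILY DOOR `hTJ ⟸ hHcol ∧ hC157` — THE EX DISPLAY's OPERATOR ROW `hTJ` IS A COROLLARY OF TWO ROWS IT ALREADY DISPLAYS.**  S20ᴸ's (✓p690345) binder `hTJ` TOKEN FOR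
TOKEN with `kTJ L := 12·α L·ΘH L·g L`, from S20ᴸ's binders `hHcol` (the `ℓ¹`-column of print's `H` (3.126), [B9] Thm 3.12 (3.133) class) and `hC157` ([Balaban1985Averaging] Prop. 5 (157) for the
chart of record) VERBATIM, plus the display's positivity∕window letters `hα ha₃ hεC hef hWe hWε hΘH0 hg0`.  Chain: (J) ✓`norm_actionGrad_le_of_regPr` ((28) at `RegPr`), (H) ✓`sum_norm_H46P_le_of_column`,
(q) ✓`sum_norm_avgHess_single_le_of_entry_row` (`qA := 6·g`), duality ✓`norm_TJP_apply_le_of_columns`.  Dimension line: `(2∕η²)·(η³α)·(η·ΘH·η⁻³)·(6g·η) = 12·α·ΘH·g`.  After this door the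
display may instantiate `kTJ := fun L ↦ 12 * α L * ΘH L * g L` and drop the row.  CONDITIONAL on the displayed rows; nothing of the stub, the crux, d = 4 or the gap is claimed.
[cite: Balaban1985BackgroundPropagators, (3.137) p.423, (3.127)–(3.128) p.421, (3.126) p.420, (3.133) p.422, (3.11)–(3.14) pp.392–393; Balaban1985Averaging, Prop. 5 (157) p.42, (110) p.34; Balaban1985Variational, (27)–(28) p.282, (72)–(73) p.289] -/
theorem hTJ_of_hHcol_h157
    (Lift : ∀ (L : ℕ) (i : Idx L), GaugeField (i.1.1.P i.1.2.2) 0 (Matrix.specialUnitaryGroup (Fin 2) ℂ) → Prop)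
    [hFL : ∀ F : T3Family, Fact (0 < (F.L : ℝ))] [hFη : ∀ (F : T3Family) (k : ℕ), Fact (0 < ((F.L : ℝ)⁻¹) ^ k)]
    (a₃ α : ℕ → ℝ) (ha₃ : ∀ L, 1 < L → 0 < a₃ L) (hα : ∀ L, 1 < L → 0 < α L)
    (c₀ cB : ℕ → ℝ) [hc₀ : ∀ L : ℕ, Fact (0 < c₀ L)] [hcB : ∀ L : ℕ, Fact (0 < cB L)]
    (a : ∀ L : ℕ, Idx L → ℝ)
    (εC : ℕ → ℝ) (ΘH g : ℕ → ℝ) (hΘH0 : ∀ L, 1 < L → 0 ≤ ΘH L) (hg0 : ∀ L, 1 < L → 0 ≤ g L)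
    (hHcol : ∀ (L : ℕ), 1 < L → ∀ (i : Idx L) (U₀ : GaugeField (i.1.1.P i.1.2.2) 0 (Matrix.specialUnitaryGroup (Fin 2) ℂ)), RegPr i.1.1 i.1.2.1 i.1.2.2 (α L) U₀ → Lift L i U₀ →
      ∃ hk : Bond 3 (periodsT3 i.1.1 i.1.2.2) → PBond (i.1.1.P i.1.2.1) 0 → ℝ, (∀ b' y, 0 ≤ hk b' y) ∧
        (∀ (y : PBond (i.1.1.P i.1.2.1) 0) (Z : Matrix (Fin 2) (Fin 2) ℂ) (b' : Bond 3 (periodsT3 i.1.1 i.1.2.2)), ‖flat115 ((H1f i.1.1 i.1.2.1 i.1.2.2 i.2.2.le (c₀ L) (cB L) (a L i) (DeltaPiSlotP i.1.1 i.1.2.1 i.1.2.2 i.2.2.le (c₀ L) (cB L) (a L i)) U₀) (Pi.single y Z)) b'‖ ≤ hk b' y * ‖Z‖) ∧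
        (∀ y : PBond (i.1.1.P i.1.2.1) 0, ∑ b' : Bond 3 (periodsT3 i.1.1 i.1.2.2), hk b' y ≤ ΘH L * ((L : ℝ) ^ (i.1.2.2 - i.1.2.1)) ^ 3))
    (hC157 : ∀ (L : ℕ), 1 < L → ∀ (i : Idx L) (U₀ : GaugeField (i.1.1.P i.1.2.2) 0 (Matrix.specialUnitaryGroup (Fin 2) ℂ)), RegPr i.1.1 i.1.2.1 i.1.2.2 (α L) U₀ →
      ∀ B : PBond (i.1.1.P i.1.2.2) 0 → Matrix (Fin 2) (Fin 2) ℂ, ‖B‖ < (εC L + a₃ L) * eta i.1.1 i.1.2.1 i.1.2.2 →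
      ∀ (b₀ : PBond (i.1.1.P i.1.2.2) 0) (δ : PBond (i.1.1.P i.1.2.2) 0 → Matrix (Fin 2) (Fin 2) ℂ), (∀ b, b ≠ b₀ → δ b = 0) →
      ∀ c : PBond (i.1.1.P i.1.2.1) 0, ‖fderiv ℂ (CmapTwS i.1.1 i.1.2.1 i.1.2.2 i.2.2.le U₀) B δ c‖ ≤ g L * ((L : ℝ) ^ (i.1.2.2 - i.1.2.1))⁻¹ * ‖B‖ * ‖δ‖)
    (ef : ℕ → ℝ) (hef : ∀ L, 1 < L → 0 < ef L)
    (hWe : ∀ L : ℕ, 1 < L → 10 ^ 9 * (L : ℝ) ^ 2 * ef L ≤ 1) (hWε : ∀ L : ℕ, 1 < L → 10 ^ 12 * (L : ℝ) ^ 3 * α L ≤ 1)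
    (hεC : ∀ L : ℕ, 1 < L → 0 ≤ εC L) :
    ∀ (L : ℕ), 1 < L → ∀ (i : Idx L) (U₀ : GaugeField (i.1.1.P i.1.2.2) 0 (Matrix.specialUnitaryGroup (Fin 2) ℂ)), RegPr i.1.1 i.1.2.1 i.1.2.2 (α L) U₀ → Lift L i U₀ →
      ∀ (X : PBond (i.1.1.P i.1.2.2) 0 → Matrix (Fin 2) (Fin 2) ℂ) (s : ℝ), (∀ bd, ‖X bd‖ ≤ s) →
        ∀ bd : PBond (i.1.1.P i.1.2.2) 0, ‖(toL2 i.1.1 i.1.2.2 (c₀ L)).symm (TJSlotP i.1.1 i.1.2.1 i.1.2.2 i.2.2.le (c₀ L) (cB L) (a L i) U₀ (toL2 i.1.1 i.1.2.2 (c₀ L) X)) bd‖ ≤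
          12 * α L * ΘH L * g L * s := by
  -- the (q) row at `qA := 6·g` from `hC157`, member by member
  have hq : ∀ (L : ℕ), 1 < L → ∀ (i : Idx L) (U₀ : GaugeField (i.1.1.P i.1.2.2) 0 (Matrix.specialUnitaryGroup (Fin 2) ℂ)), RegPr i.1.1 i.1.2.1 i.1.2.2 (α L) U₀ →
      ∀ (X' : PBond (i.1.1.P i.1.2.2) 0 → Matrix (Fin 2) (Fin 2) ℂ) (s : ℝ) (bd : PBond (i.1.1.P i.1.2.2) 0) (E : Matrix (Fin 2) (Fin 2) ℂ), (∀ b, ‖X' b‖ ≤ s) →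
        ∑ y : PBond (i.1.1.P i.1.2.1) 0, ‖avgHess i.1.1 i.1.2.1 i.1.2.2 i.2.2.le U₀ X' (Pi.single bd E) y‖ ≤ (6 * g L) * ((L : ℝ) ^ (i.1.2.2 - i.1.2.1))⁻¹ * s * ‖E‖ := by
    intro L hL i U₀ hU X' s bd E hX'
    have hLi : (i.1.1.L : ℝ) = (L : ℝ) := by exact_mod_cast i.2.1
    have hLpos : (0 : ℝ) < L := by exact_mod_cast (zero_lt_one.trans hL)
    have hWe' : 10 ^ 9 * (i.1.1.L : ℝ) ^ 2 * ef L ≤ 1 := by rw [hLi]; exact hWe L hL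
    have hWε' : 10 ^ 12 * (i.1.1.L : ℝ) ^ 3 * α L ≤ 1 := by rw [hLi]; exact hWε L hL
    have hr : 0 < (εC L + a₃ L) * eta i.1.1 i.1.2.1 i.1.2.2 := mul_pos (by linarith [hεC L hL, ha₃ L hL]) (eta_pos _ _ _)
    have hg' : 0 ≤ g L * ((L : ℝ) ^ (i.1.2.2 - i.1.2.1))⁻¹ := by have := hg0 L hL; positivity
    have h := sum_norm_avgHess_single_le_of_entry_row (h := i.2.2.le) (hα L hL) (hef L hL) hWe' hWε' hr hg' U₀ hU (hC157 L hL i U₀ hU) X' s bd E hX'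
    calc ∑ y : PBond (i.1.1.P i.1.2.1) 0, ‖avgHess i.1.1 i.1.2.1 i.1.2.2 i.2.2.le U₀ X' (Pi.single bd E) y‖ ≤ 6 * (g L * ((L : ℝ) ^ (i.1.2.2 - i.1.2.1))⁻¹) * s * ‖E‖ := h
      _ = (6 * g L) * ((L : ℝ) ^ (i.1.2.2 - i.1.2.1))⁻¹ * s * ‖E‖ := by ring
  intro L hL i U₀ hU hLift X s hX bd
  have h := Prop7TJRowOfColumnsLift.hTJ_of_hHcol_hq Lift α ΘH (fun L => 6 * g L) hα hΘH0 (fun L hL => by have := hg0 L hL; positivity) c₀ cB a hHcol hq L hL i U₀ hU hLift X s hX bd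
  calc ‖(toL2 i.1.1 i.1.2.2 (c₀ L)).symm (TJSlotP i.1.1 i.1.2.1 i.1.2.2 i.2.2.le (c₀ L) (cB L) (a L i) U₀ (toL2 i.1.1 i.1.2.2 (c₀ L) X)) bd‖ ≤ 2 * α L * ΘH L * (6 * g L) * s := h
    _ = 12 * α L * ΘH L * g L * s := by ring


end Summit.QuantumFields.YangMills.Theorems.Prop7TJRowOfEntry157Lift

end
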